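import Mathlib.Tactic.Linarith
import Summits.Ventures.PercRepro.MSTightProj

/-!
# The twin dichotomy of Marica–Schönheim-tight families with a down-closed difference family

`MSTightProj.lean` records the projection identity of a family `F` of finite sets along an element
`r`: with `F₀ = part0 r F` (members avoiding `r`), `L = partr r F` (members containing `r`, with `r`
removed), `K = partner r F = F₀ ∩ L` (the `r`-twin pairs), `X = diffsX r F` (the differences avoiding
`r`) and `Y = diffsY r F = L \\ F₀` (the differences containing `r`, with `r` removed),
`|F \\ F| = |X| + |Y|`, `proj r F \\ proj r F = X ∪ Y`, `K \\ K ⊆ X ∩ Y`, and for a TIGHT `F`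
(`|F \\ F| = |F|`) the projection and `K` are tight with `X ∩ Y = K \\ K` (`tight_proj_and_partner`).

This file adds the hypothesis that the difference family `F \\ F` is a DOWN-SET (closed under
subsets) — the situation of Lemma B, where the differences of a column are good `⊥`-sets
(`LemmaBSlackTwo.botSet_lowerSet`). Then `Y ⊆ X` (`diffsY_subset_diffsX`), so for tight `F` the
`r`-differences are exactly the twin differences, `Y = K \\ K`, and `|Y| = |K|`. Feeding this into
the two-family Marica–Schönheim inequality `|F₀| |L| ≤ |F₀ \\ L| |L \\ F₀|`
(`Finset.le_card_diffs_mul_card_diffs`, Mathlib) with `F₀ \\ L ⊆ X`, `|X| = |F₀| + |L| − |K|` gives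
`(|F₀| − |K|)(|L| − |K|) ≤ 0`, i.e.

* **`part0_subset_partr_or_partr_subset_part0`** (the twin dichotomy): for every `r`, either every
  member avoiding `r` has its `r`-twin in `F`, or every member containing `r` has its `r`-deletion
  in `F`.

Consequences: a tight family with a down-closed difference family is closed under adding the
elements of one class and deleting those of the other; in particular it has a minimum or a maximum
as soon as one class is empty. The dichotomy is sharp in the sense that both alternatives occur
(`{1, 2, 12} × {∅, 3, 4}` is tight with neither a minimum nor a maximum: `1, 2 ∈ F` have twins in
direction `3`, while in direction `1` every member containing `1` loses it — this corrects the
«minimum or maximum» claim of proofs/P4-gen8.md §4). Exhaustively checked on `[4]` (all 324 tight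
families with a down-closed difference family) and `[5]` (`|F| ≤ 12`, 3,552 families), 0 exceptions
(p4 gen 9, mining/p4/g9/dichot.py).
-/

namespace PercRepro.MSTight

open Finset
open scoped FinsetFamily

variable {α : Type*} [DecidableEq α]

/-- A family of finite sets is a **down-set** when it is closed under taking subsets. -/
def IsDownSet (G : Finset (Finset α)) : Prop := ∀ W ∈ G, ∀ W' ⊆ W, W' ∈ G

/-- When the difference family is down-closed, every `r`-difference with `r` removed is itself an
`r`-free difference: `Y ⊆ X`. -/
theorem diffsY_subset_diffsX {r : α} {F : Finset (Finset α)} (hD : IsDownSet (F \\ F)) :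
    diffsY r F ⊆ diffsX r F := by
  intro E hE
  have hr : r ∉ E := notMem_of_mem_diffsY hE
  obtain ⟨A, hA, B, hB, rfl⟩ := Finset.mem_diffs.1 hE
  obtain ⟨hrA, hA'⟩ := mem_partr.1 hA
  obtain ⟨hB', hrB⟩ := mem_part0.1 hB
  -- `insert r A \ B` is a difference of members; `A \ B` is a subset of it
  have hmem : insert r A \ B ∈ F \\ F := Finset.mem_diffs.2 ⟨_, hA', _, hB', rfl⟩
  have hsub : A \ B ⊆ insert r A \ B := Finset.sdiff_subset_sdiff (Finset.subset_insert r A) le_rfl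
  have hE' : A \ B ∈ F \\ F := hD _ hmem _ hsub
  rw [← diffs_filter_notMem, Finset.mem_filter]
  exact ⟨hE', hr⟩

/-- The members avoiding `r` and the members containing `r` (with `r` removed) partition the count
of `F`: `|F| = |part0 r F| + |partr r F|`. -/
theorem card_eq_card_part0_add_card_partr (r : α) (F : Finset (Finset α)) :
    F.card = (part0 r F).card + (partr r F).card := by
  have h1 : (partr r F).card = (F.filter fun A => r ∈ A).card := by
    unfold partr
    apply Finset.card_image_of_injOn
    intro A hA B hB h
    simp only [Finset.coe_filter, Set.mem_setOf_eq] at hA hB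
    have h' : A.erase r = B.erase r := h
    rw [← Finset.insert_erase hA.2, ← Finset.insert_erase hB.2, h']
  rw [h1, part0, add_comm, Finset.card_filter_add_card_filter_not]

/-- `|proj r F| = |part0 r F| + |partr r F| − |partner r F|` (inclusion–exclusion). -/
theorem card_proj_add_card_partner (r : α) (F : Finset (Finset α)) :
    (proj r F).card + (partner r F).card = (part0 r F).card + (partr r F).card := by
  rw [proj_eq_union, partner, Finset.card_union_add_card_inter]

/-- **The twin dichotomy.** If `F` is tight and `F \\ F` is a down-set, then for every `r` either
every member avoiding `r` has its `r`-twin in `F` (`part0 r F ⊆ partr r F`) or every member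
containing `r` has its `r`-deletion in `F` (`partr r F ⊆ part0 r F`). -/
theorem part0_subset_partr_or_partr_subset_part0 {F : Finset (Finset α)} (hF : Tight F)
    (hD : IsDownSet (F \\ F)) (r : α) :
    part0 r F ⊆ partr r F ∨ partr r F ⊆ part0 r F := by
  obtain ⟨hproj, hK, hXY⟩ := tight_proj_and_partner (r := r) hF
  have hYX : diffsY r F ⊆ diffsX r F := diffsY_subset_diffsX hD
  -- `Y = K \\ K`, hence `|Y| = |K|`
  have hY : diffsY r F = partner r F \\ partner r F := by
    rw [← hXY, Finset.inter_eq_right.2 hYX]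
  have hcardY : (diffsY r F).card = (partner r F).card := by
    rw [hY]; exact hK
  -- `|X| = |proj r F|` since `proj \\ proj = X ∪ Y = X`
  have hX : (diffsX r F).card = (proj r F).card := by
    have := diffs_proj_eq r F
    rw [Finset.union_eq_left.2 hYX] at this
    rw [← this]; exact hproj
  -- `F₀ \\ L ⊆ X`
  have hsub : part0 r F \\ partr r F ⊆ diffsX r F := fun E hE =>
    Finset.mem_union.2 (Or.inr hE)
  -- the two-family Marica–Schönheim inequality
  have hDL := Finset.le_card_diffs_mul_card_diffs (part0 r F) (partr r F)
  have h1 : (part0 r F \\ partr r F).card ≤ (proj r F).card :=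
    hX ▸ Finset.card_le_card hsub
  have h2 : (partr r F \\ part0 r F).card = (partner r F).card := hcardY
  have hpk := card_proj_add_card_partner r F
  have hK0 : (partner r F).card ≤ (part0 r F).card :=
    Finset.card_le_card Finset.inter_subset_left
  have hKr : (partner r F).card ≤ (partr r F).card :=
    Finset.card_le_card Finset.inter_subset_right
  -- arithmetic: `a b ≤ (a + b − k) k` with `k ≤ a, b` forces `a = k` or `b = k`
  set a := (part0 r F).card with ha
  set b := (partr r F).card with hb
  set k := (partner r F).card with hk
  have hab : a * b ≤ (a + b - k) * k := by
    calc a * b ≤ (part0 r F \\ partr r F).card * (partr r F \\ part0 r F).card := hDL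
      _ ≤ (proj r F).card * k := Nat.mul_le_mul h1 (le_of_eq h2)
      _ = (a + b - k) * k := by
        congr 1
        omega
  obtain ⟨p, hp⟩ := Nat.exists_eq_add_of_le hK0
  obtain ⟨q, hq⟩ := Nat.exists_eq_add_of_le hKr
  have hpq : p * q = 0 := by
    rw [hp, hq] at hab
    have : (k + p + (k + q) - k) * k = (k + p + q) * k := by congr 1; omega
    rw [this] at hab
    nlinarith
  rcases Nat.mul_eq_zero.1 hpq with h0 | h0
  · -- `a = k`: the members avoiding `r` are exactly the partner family
    left
    have : part0 r F = partner r F := by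
      symm
      apply Finset.eq_of_subset_of_card_le (Finset.inter_subset_left (s₁ := part0 r F) (s₂ := partr r F))
      show (part0 r F).card ≤ (partner r F).card
      omega
    rw [this]
    exact Finset.inter_subset_right
  · -- `b = k`: the members containing `r`, minus `r`, are exactly the partner family
    right
    have : partr r F = partner r F := by
      symm
      apply Finset.eq_of_subset_of_card_le (Finset.inter_subset_right (s₁ := part0 r F) (s₂ := partr r F))
      show (partr r F).card ≤ (partner r F).card
      omega
    rw [this]
    exact Finset.inter_subset_left

/-- Reading of the dichotomy on members: for every `r` and every member `A ∈ F`, either (`r ∉ A`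
and `insert r A ∈ F`) for ALL members avoiding `r`, or (`r ∈ A` and `A.erase r ∈ F`) for ALL members
containing `r`. -/
theorem forall_insert_mem_or_forall_erase_mem {F : Finset (Finset α)} (hF : Tight F)
    (hD : IsDownSet (F \\ F)) (r : α) :
    (∀ A ∈ F, r ∉ A → insert r A ∈ F) ∨ (∀ A ∈ F, r ∈ A → A.erase r ∈ F) := by
  rcases part0_subset_partr_or_partr_subset_part0 hF hD r with h | h
  · left
    intro A hA hrA
    exact (mem_partr.1 (h (mem_part0.2 ⟨hA, hrA⟩))).2
  · right
    intro A hA hrA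
    have : A.erase r ∈ partr r F :=
      mem_partr.2 ⟨Finset.notMem_erase r A, by rw [Finset.insert_erase hrA]; exact hA⟩
    exact (mem_part0.1 (h this)).1

/-- If some coordinate `r` lies in no member of a tight family with down-closed differences and
some member avoids … — the trivial reading: when `partr r F = ∅` the first alternative says that
`part0 r F = ∅` as well, i.e. `F = ∅`. Stated for completeness: a nonempty tight family with a
down-closed difference family in which some member contains `r` and some member avoids `r` has a
twin pair at `r`. -/
theorem partner_nonempty_of_both {F : Finset (Finset α)} (hF : Tight F)
    (hD : IsDownSet (F \\ F)) {r : α} (h0 : (part0 r F).Nonempty) (hr : (partr r F).Nonempty) :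
    (partner r F).Nonempty := by
  rcases part0_subset_partr_or_partr_subset_part0 hF hD r with h | h
  · obtain ⟨A, hA⟩ := h0
    exact ⟨A, Finset.mem_inter.2 ⟨hA, h hA⟩⟩
  · obtain ⟨A, hA⟩ := hr
    exact ⟨A, Finset.mem_inter.2 ⟨h hA, hA⟩⟩

end PercRepro.MSTight
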